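/-
Cell b2b-lgcu-borel (gen 26).  VALUE = THEOREM (an all-`p`, all-`m`, all-`ε` law on every hypothetical
witness), NOT summit progress; the crux item `SubgroupIdentityDesigns` (stmt-14079) stays open and untouched.
-/
import Mathlib
import Summits.MatrixMultiplication.MatrixMultiplication.Theorems.SubgroupIdentityDesigns.Negative.CharacterLaw
import Summits.MatrixMultiplication.MatrixMultiplication.Theorems.SubgroupIdentityDesigns.Negative.FixedPointLaw

/-!
# The rank-one law: members containing a transvection or a homology

Route `LevelGradedCohnUmans`, crux `SubgroupIdentityDesigns` (stmt-MatrixMultiplication-14079), level-one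
cells `(m, k) = (m, 1)`; report `run/shared/lean/b2b/levelgraded-cu/ORACLE-g26.md` §G26-4.

## The law (`x, y, z = |H₁|, |H₂|, |H₃|`, `b = #ℙ^{m-1}(𝔽_p)`)

Call `g ∈ GL_m(𝔽_p)` a RANK-ONE ELEMENT if `g = 1 + u ⊗ φ` with `u ≠ 0`, `φ ≠ 0` (`Matrix.vecMulVec`):
the transvections (`φ(u) = 0`) and the homologies / reflections (`φ(u) ≠ 0`: diagonalisable, fixed
hyperplane `ker φ`, one eigenvalue `1 + φ(u) ≠ 1`).  For every subgroup-TPP triple carrying a level-one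
identity design (the data of the crux at `k = 1`, any exponent):

* `crux_right`:  `H₃ ∋ g` rank-one ⟹ `(x + y − 1) · z ≤ p^{m-1} (p − 1) · b`;
* `crux_left`:   `H₁ ∋ g` rank-one ⟹ `(z + y − 1) · x ≤ p^{m-1} (p − 1) · b`;
* `crux_middle`: `H₂ ∋ g` rank-one ⟹ `x · y ≤ p^{m-1} (p − 1) · b` and `z · y ≤ p^{m-1} (p − 1) · b`.

Since `(p − 1) b = p^m − 1`, the right-hand side is `p^{m-1} (p^m − 1)`, against the Neumann counts
`(x + y − 1) z ≤ dim F_1 = (p − 1) b² − 2b + 2 ≈ p^{m-1} (p^m − 1) · p/(p−1)` (`WitnessNeumannCounts`,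
`LevelOneExact`): a sharpening by the factor `(p − 1)/p` for every member containing a rank-one element —
in particular for every member whose order is divisible by `p` and whose Sylow `p`-subgroup contains a
transvection (classes N₁-transvection, N₂, S of `MemberTrichotomy` at `m = 3`), and for every `p'`-member
containing a homology `diag(1, …, 1, λ)`.

## Mechanism

`CharacterLaw.law_right` with `K = ⟨g⟩` and any `σ ≠ 1`: `(x + y − 1) [H₃ : K] ≤ ν_σ(K) · b`.  The new
input is the exact evaluation `|K| · ν_σ(K) ≤ p^m − p^{m-1}` (`card_mul_card_admOrb_add_le`), valid for
every subgroup `K` all of whose non-identity elements have the SAME fixed space `W` (here `W = ker φ`,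
`|W| = p^{m-1}`): Burnside gives `|Ω_K| · |K| = p^m + (|K| − 1) |W|` (`card_orbits_eq`), and the `|W|`
singleton orbits of the vectors of `W` are not `σ`-admissible (their stabiliser is all of `K`), so
`ν_σ ≤ |Ω_K| − |W|`.  (Equivalently `ν_σ(K) = ⟨π|_K, σ⟩` with `π(k) = p^{dim Fix k}`, and
`Σ_{k ∈ K} π(k) σ̄(k) = p^m − p^{m-1}` for a rank-one cyclic group.)  The powers of `1 + u ⊗ φ` are
`1 + a (u ⊗ φ)` (`coe_pow_eq`), so `⟨g⟩` has the common fixed space `ker φ` (`fixSub_eq_of_mem_zpowers`);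
a non-trivial character of the non-trivial cyclic group `⟨g⟩` exists (`exists_char_ne_one`, via
`zmodCyclicMulEquiv` and `ZMod.stdAddChar`).

Data (gen 26, `(m, p) = (3, 11)`, `code/g26/prune_p11_v2.py`): the bound `(x + y − 1) z ≤ 160 930` (vs.
`176 626`) removes e.g. the order triple `(220, 570, 220)` (transvection-type ends, `789 · 220 = 173 580`),
the largest survivor of all earlier laws.  HONEST SCOPE: a law on members; it empties no `(m, 1, p)` cell
by itself.

Sorry-free; standard axioms.
-/

set_option linter.dupNamespace false

noncomputable section

open scoped BigOperators Classical Matrix LinearAlgebra.Projectivization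
open Module (finrank)
open Matrix (vecMulVec)

namespace Summit.MatrixMultiplication.MatrixMultiplication.Theorems.SubgroupIdentityDesigns.Negative
namespace RankOneLaw

open Summit.MatrixMultiplication.MatrixMultiplication.Theorems.LieRankDesigns.Negative (GLm Mat)
open Summit.MatrixMultiplication.MatrixMultiplication.Theorems.LevelOneGL2Designs.Negative
open Literature.Barriers.MatrixMultiplication (SubgroupTPP)
open LevelOneInvariantDim (Ω orb exists_smul_eq_out)
open LevelOneEquivariantDim (adm AdmOrb mem_adm exists_ne_one)
open FixedPointLaw (fixSub mem_fixSub fixDim natCard_fixSub fixExcess card_orbits_mul_card)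
open CharacterLaw (crux_law_right' crux_law_left' crux_law_middle')

variable {p m : ℕ} [hp : Fact p.Prime]

/-! ## 1. Subgroups with a common fixed space -/

section Common

variable {K : Subgroup (GLm p m)} {W : Submodule (ZMod p) (Fin m → ZMod p)}

/-- Every element of such a `K` fixes `W` pointwise. -/
theorem smul_eq_of_mem (hW : ∀ k : K, k ≠ 1 → fixSub (k : GLm p m) = W) (k : K)
    {w : Fin m → ZMod p} (hw : w ∈ W) : k • w = w := by
  by_cases hk : k = 1
  · rw [hk, one_smul]
  · have h : w ∈ fixSub (k : GLm p m) := by rw [hW k hk]; exact hw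
    exact mem_fixSub.1 h

/-- The fixed-point excess: `Φ(K) = (|K| − 1) (|W| − 1)`. -/
theorem fixExcess_eq (hW : ∀ k : K, k ≠ 1 → fixSub (k : GLm p m) = W) :
    fixExcess K = (Nat.card K - 1) * (Nat.card W - 1) := by
  have h : ∀ k ∈ (Finset.univ : Finset K).erase 1,
      p ^ fixDim (k : GLm p m) - 1 = Nat.card W - 1 := by
    intro k hk
    rw [← natCard_fixSub, hW k (Finset.ne_of_mem_erase hk)]
  rw [fixExcess, Finset.sum_congr rfl h, Finset.sum_const, smul_eq_mul,
    Finset.card_erase_of_mem (Finset.mem_univ _), Finset.card_univ, ← Nat.card_eq_fintype_card]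

/-- Burnside for such a `K`: `|Ω_K| · |K| = p^m + (|K| − 1) · |W|`. -/
theorem card_orbits_eq (hW : ∀ k : K, k ≠ 1 → fixSub (k : GLm p m) = W) :
    Nat.card (Ω K) * Nat.card K = p ^ m + (Nat.card K - 1) * Nat.card W := by
  have h := card_orbits_mul_card K
  rw [fixExcess_eq hW] at h
  obtain ⟨b, hb⟩ : ∃ b, Nat.card K = b + 1 := ⟨Nat.card K - 1, (Nat.succ_pred_eq_of_pos Nat.card_pos).symm⟩
  obtain ⟨c, hc⟩ : ∃ c, Nat.card W = c + 1 := ⟨Nat.card W - 1, (Nat.succ_pred_eq_of_pos Nat.card_pos).symm⟩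
  rw [hb, hc] at h ⊢
  simp only [Nat.add_sub_cancel] at h ⊢
  have h2 : Nat.card (Ω K) * (b + 1) + 1 = (p ^ m + b * (c + 1)) + 1 := by rw [h]; ring
  omega

/-- **`|K| · ν_σ(K) + |W| ≤ p^m`** for every `σ ≠ 1`: the vectors of `W` are singleton, non-admissible
orbits. -/
theorem card_mul_card_admOrb_add_le (hW : ∀ k : K, k ≠ 1 → fixSub (k : GLm p m) = W)
    {σ : K →* ℂˣ} (hσ : σ ≠ 1) :
    Nat.card K * Nat.card (AdmOrb K σ) + Nat.card W ≤ p ^ m := by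
  -- vectors of `W` are not admissible
  have hnadm : ∀ w ∈ W, w ∉ adm K σ := by
    intro w hw hadm
    obtain ⟨k, hk⟩ := exists_ne_one hσ
    exact hk (hadm k (smul_eq_of_mem hW k hw))
  -- the orbit of `w ∈ W` is `{w}`: its chosen representative is `w`
  have hout : ∀ w ∈ W, ((orb K w).out : Fin m → ZMod p) = w := by
    intro w hw
    obtain ⟨k, hk⟩ := exists_smul_eq_out K w
    rw [← hk, smul_eq_of_mem hW k hw]
  -- injection `W ↪ {non-admissible orbits}`
  let ι : W → {ω : Ω K // ω.out ∉ adm K σ} :=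
    fun w => ⟨orb K (w : Fin m → ZMod p), by rw [hout _ w.2]; exact hnadm _ w.2⟩
  have hι : Function.Injective ι := by
    intro w₁ w₂ h
    have h' : orb K (w₁ : Fin m → ZMod p) = orb K (w₂ : Fin m → ZMod p) := congrArg Subtype.val h
    obtain ⟨k, hk⟩ := MulAction.mem_orbit_iff.1 (MulAction.orbitRel_apply.1 (Quotient.exact h'))
    apply Subtype.ext
    rw [← hk, smul_eq_of_mem hW k w₂.2]
  have h1 : Nat.card W ≤ Nat.card {ω : Ω K // ω.out ∉ adm K σ} := Nat.card_le_card_of_injective ι hι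
  -- admissible + non-admissible orbits = all orbits
  have h2 : Nat.card (AdmOrb K σ) + Nat.card {ω : Ω K // ω.out ∉ adm K σ} = Nat.card (Ω K) := by
    rw [Nat.card_eq_fintype_card, Nat.card_eq_fintype_card, Nat.card_eq_fintype_card,
      Fintype.card_subtype_compl, Nat.add_sub_cancel' (Fintype.card_subtype_le _)]
  have h3 := card_orbits_eq hW
  obtain ⟨b, hb⟩ : ∃ b, Nat.card K = b + 1 := ⟨Nat.card K - 1, (Nat.succ_pred_eq_of_pos Nat.card_pos).symm⟩
  rw [hb] at h3 ⊢
  simp only [Nat.add_sub_cancel] at h3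
  have h4 : (b + 1) * (Nat.card (AdmOrb K σ) + Nat.card W) ≤ (b + 1) * Nat.card (Ω K) :=
    Nat.mul_le_mul_left _ (by omega)
  have h5 : (b + 1) * Nat.card (Ω K) = p ^ m + b * Nat.card W := by rw [mul_comm, h3]
  nlinarith [h4, h5]

end Common

/-! ## 2. Rank-one elements `1 + u ⊗ φ` -/

section RankOne

variable {g : GLm p m} {u φ : Fin m → ZMod p}

/-- `(u ⊗ φ) v = φ(v) · u`. -/
theorem vecMulVec_mulVec_eq (u φ v : Fin m → ZMod p) : vecMulVec u φ *ᵥ v = (φ ⬝ᵥ v) • u := by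
  ext i
  simp [Matrix.mulVec, dotProduct, Matrix.vecMulVec_apply, Finset.mul_sum, mul_comm, mul_left_comm]

/-- The fixed vectors of `1 + a (u ⊗ φ)` (`a ≠ 0`, `u ≠ 0`) are exactly `ker φ`. -/
theorem fix_iff (hu : u ≠ 0) {a : ZMod p} (ha : a ≠ 0) (v : Fin m → ZMod p) :
    (1 + a • vecMulVec u φ) *ᵥ v = v ↔ φ ⬝ᵥ v = 0 := by
  rw [Matrix.add_mulVec, Matrix.one_mulVec, Matrix.smul_mulVec, vecMulVec_mulVec_eq, add_eq_left,
    smul_smul, smul_eq_zero, mul_eq_zero]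
  constructor
  · rintro ((h | h) | h)
    · exact absurd h ha
    · exact h
    · exact absurd h hu
  · intro h; exact Or.inl (Or.inr h)

/-- Powers of `g = 1 + u ⊗ φ`: `g^n = 1 + a_n (u ⊗ φ)` for some scalar `a_n`. -/
theorem coe_pow_eq (hg : (g : Mat p m) = 1 + vecMulVec u φ) (n : ℕ) :
    ∃ a : ZMod p, ((g ^ n : GLm p m) : Mat p m) = 1 + a • vecMulVec u φ := by
  induction n with
  | zero => exact ⟨0, by simp⟩
  | succ n ih =>
    obtain ⟨a, ha⟩ := ih
    refine ⟨a + 1 + a * (φ ⬝ᵥ u), ?_⟩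
    have hNN : vecMulVec u φ * vecMulVec u φ = (φ ⬝ᵥ u) • vecMulVec u φ := by
      rw [Matrix.vecMulVec_mul_vecMulVec, Matrix.vecMulVec_smul]
    rw [pow_succ, Units.val_mul, ha, hg, add_mul, mul_add, mul_add, one_mul, mul_one, one_mul,
      Matrix.smul_mul, hNN, smul_smul]
    module

/-- A rank-one element is not the identity. -/
theorem ne_one (hg : (g : Mat p m) = 1 + vecMulVec u φ) (hu : u ≠ 0) (hφ : φ ≠ 0) : g ≠ 1 := by
  intro h
  have h1 : (g : Mat p m) = 1 := by rw [h, Units.val_one]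
  rw [hg, add_eq_left] at h1
  exact Matrix.vecMulVec_ne_zero hu hφ h1

/-- Every element of `⟨g⟩` is `1` or has the fixed space of `g`. -/
theorem fixSub_eq_of_mem_zpowers (hg : (g : Mat p m) = 1 + vecMulVec u φ) (hu : u ≠ 0)
    {k : GLm p m} (hk : k ∈ Subgroup.zpowers g) (hk1 : k ≠ 1) : fixSub k = fixSub g := by
  rw [← mem_powers_iff_mem_zpowers, Submonoid.mem_powers_iff] at hk
  obtain ⟨n, rfl⟩ := hk
  obtain ⟨a, ha⟩ := coe_pow_eq hg n
  have ha0 : a ≠ 0 := by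
    rintro rfl
    apply hk1
    apply Units.ext
    rw [ha, zero_smul, add_zero, Units.val_one]
  ext v
  rw [mem_fixSub, mem_fixSub, ha, hg, fix_iff hu ha0]
  conv_rhs => rw [show (1 : Mat p m) + vecMulVec u φ = 1 + (1 : ZMod p) • vecMulVec u φ by
    rw [one_smul]]
  rw [fix_iff hu one_ne_zero]

/-- The functional `v ↦ φ(v)`. -/
def fnl (φ : Fin m → ZMod p) : (Fin m → ZMod p) →ₗ[ZMod p] ZMod p where
  toFun v := φ ⬝ᵥ v
  map_add' v w := dotProduct_add φ v w
  map_smul' c v := by rw [dotProduct_smul, RingHom.id_apply]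

/-- `fnl φ v = φ(v)`. -/
theorem fnl_apply (φ v : Fin m → ZMod p) : fnl φ v = φ ⬝ᵥ v := rfl

/-- A non-zero functional is surjective. -/
theorem fnl_surjective (hφ : φ ≠ 0) : Function.Surjective (fnl φ) := by
  obtain ⟨i, hi⟩ : ∃ i, φ i ≠ 0 := Function.ne_iff.1 hφ
  intro t
  refine ⟨Pi.single i ((φ i)⁻¹ * t), ?_⟩
  rw [fnl_apply, dotProduct_single, mul_inv_cancel_left₀ hi]

/-- The fixed space of a rank-one element is the hyperplane `ker φ`. -/
theorem fixSub_eq_ker (hg : (g : Mat p m) = 1 + vecMulVec u φ) (hu : u ≠ 0) :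
    fixSub g = LinearMap.ker (fnl φ) := by
  ext v
  rw [mem_fixSub, hg, LinearMap.mem_ker, fnl_apply]
  conv_lhs => rw [show (1 : Mat p m) + vecMulVec u φ = 1 + (1 : ZMod p) • vecMulVec u φ by
    rw [one_smul]]
  exact fix_iff hu one_ne_zero v

/-- `|Fix(g)| = p^{m-1}` for a rank-one `g`. -/
theorem natCard_fixSub_eq (hg : (g : Mat p m) = 1 + vecMulVec u φ) (hu : u ≠ 0) (hφ : φ ≠ 0) :
    Nat.card (fixSub g) = p ^ (m - 1) := by
  have hm : m ≠ 0 := by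
    rintro rfl
    exact hφ (funext fun i => Fin.elim0 i)
  rw [fixSub_eq_ker hg hu]
  have h1 := Submodule.card_eq_card_quotient_mul_card (LinearMap.ker (fnl φ))
  have h2 : Nat.card ((Fin m → ZMod p) ⧸ LinearMap.ker (fnl φ)) = p := by
    rw [Nat.card_congr (LinearMap.quotKerEquivOfSurjective (fnl φ) (fnl_surjective hφ)).toEquiv,
      Nat.card_zmod]
  rw [h2, Nat.card_fun, Nat.card_zmod, Nat.card_eq_fintype_card, Fintype.card_fin] at h1
  have h3 : p ^ m = p ^ (m - 1) * p := by
    rw [← pow_succ, Nat.sub_add_cancel (Nat.one_le_iff_ne_zero.2 hm)]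
  rw [h3] at h1
  exact (Nat.eq_of_mul_eq_mul_right hp.out.pos h1).symm

end RankOne

/-! ## 3. Non-trivial characters of non-trivial cyclic subgroups -/

/-- A finite cyclic group of order `≠ 1` has a non-trivial character into `ℂˣ`. -/
theorem exists_char_ne_one {G : Type*} [Group G] [Finite G] (C : Subgroup G) [IsCyclic C]
    (hC : Nat.card C ≠ 1) : ∃ σ : C →* ℂˣ, σ ≠ 1 := by
  haveI : NeZero (Nat.card C) := ⟨Nat.card_pos.ne'⟩
  let e := zmodCyclicMulEquiv (inferInstance : IsCyclic C)
  let ψ := ZMod.stdAddChar (N := Nat.card C)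
  refine ⟨(ψ.toMonoidHom.comp e.symm.toMonoidHom).toHomUnits, fun h => ?_⟩
  have h1 := congrArg (fun σ : C →* ℂˣ => ((σ (e (Multiplicative.ofAdd 1)) : ℂˣ) : ℂ)) h
  simp only [MonoidHom.coe_toHomUnits, MonoidHom.comp_apply, MulEquiv.coe_toMonoidHom,
    MulEquiv.symm_apply_apply, AddChar.toMonoidHom_apply, toAdd_ofAdd, MonoidHom.one_apply,
    Units.val_one] at h1
  have h2 : (1 : ZMod (Nat.card C)) = 0 :=
    ZMod.injective_stdAddChar (by rw [h1, AddChar.map_zero_eq_one])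
  exact hC (ZMod.one_eq_zero_iff.1 h2)

/-! ## 4. The rank-one law -/

section Law

variable {H₁ H₂ H₃ : Subgroup (GLm p m)} {g : GLm p m} {u φ : Fin m → ZMod p}

/-- The key evaluation for the cyclic group of a rank-one element: `|⟨g⟩| · ν_σ(⟨g⟩) ≤ p^{m-1} (p − 1)`
for every `σ ≠ 1`. -/
theorem card_mul_card_admOrb_zpowers_le (hg : (g : Mat p m) = 1 + vecMulVec u φ) (hu : u ≠ 0)
    (hφ : φ ≠ 0) {σ : Subgroup.zpowers g →* ℂˣ} (hσ : σ ≠ 1) :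
    Nat.card (Subgroup.zpowers g) * Nat.card (AdmOrb (Subgroup.zpowers g) σ) ≤
      p ^ (m - 1) * (p - 1) := by
  have hW : ∀ k : Subgroup.zpowers g, k ≠ 1 → fixSub (k : GLm p m) = fixSub g := fun k hk =>
    fixSub_eq_of_mem_zpowers hg hu k.2 (fun h => hk (Subtype.ext h))
  have h := card_mul_card_admOrb_add_le hW hσ
  rw [natCard_fixSub_eq hg hu hφ] at h
  have hm : m ≠ 0 := by
    rintro rfl
    exact hφ (funext fun i => Fin.elim0 i)
  have h3 : p ^ m = p ^ (m - 1) * p := by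
    rw [← pow_succ, Nat.sub_add_cancel (Nat.one_le_iff_ne_zero.2 hm)]
  have hp1 : 1 ≤ p := hp.out.one_lt.le
  have h4 : p ^ (m - 1) * (p - 1) + p ^ (m - 1) = p ^ (m - 1) * p := by
    rw [← Nat.mul_succ, Nat.succ_eq_add_one, Nat.sub_add_cancel hp1]
  omega

/-- `⟨g⟩` is non-trivial and carries a character `σ ≠ 1`. -/
theorem exists_char_zpowers (hg : (g : Mat p m) = 1 + vecMulVec u φ) (hu : u ≠ 0) (hφ : φ ≠ 0) :
    ∃ σ : Subgroup.zpowers g →* ℂˣ, σ ≠ 1 := by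
  apply exists_char_ne_one
  rw [Nat.card_zpowers, Ne, orderOf_eq_one_iff]
  exact ne_one hg hu hφ

/-- **RANK-ONE LAW, third member**: `(x + y − 1) · z ≤ p^{m-1} (p − 1) · b`. -/
theorem crux_right (htpp : SubgroupTPP H₁ H₂ H₃)
    (hdes : ∃ c : Mat p m → ℂ, (∀ M, 1 < M.rank → c M = 0) ∧
      (∑ M, c M * ZMod.stdAddChar (Matrix.trace (M * ((1 : GLm p m) : Mat p m)))) = 1 ∧
      ∀ a ∈ H₁, ∀ b ∈ H₂, ∀ g ∈ H₃, a * b * g ≠ 1 →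
        (∑ M, c M * ZMod.stdAddChar (Matrix.trace (M * ((a * b * g : GLm p m) : Mat p m)))) = 0)
    (hg3 : g ∈ H₃) (hg : (g : Mat p m) = 1 + vecMulVec u φ) (hu : u ≠ 0) (hφ : φ ≠ 0) :
    (Nat.card H₁ + (Nat.card H₂ - 1)) * Nat.card H₃ ≤
      p ^ (m - 1) * (p - 1) * Nat.card (ℙ (ZMod p) (Fin m → ZMod p)) := by
  obtain ⟨σ, hσ⟩ := exists_char_zpowers hg hu hφ
  have h := crux_law_right' htpp hdes ((Subgroup.zpowers_le (G := GLm p m)).2 hg3) hσ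
  rw [← mul_assoc] at h
  exact h.trans (Nat.mul_le_mul_right _ (card_mul_card_admOrb_zpowers_le hg hu hφ hσ))

/-- **RANK-ONE LAW, first member**: `(z + y − 1) · x ≤ p^{m-1} (p − 1) · b`. -/
theorem crux_left (htpp : SubgroupTPP H₁ H₂ H₃)
    (hdes : ∃ c : Mat p m → ℂ, (∀ M, 1 < M.rank → c M = 0) ∧
      (∑ M, c M * ZMod.stdAddChar (Matrix.trace (M * ((1 : GLm p m) : Mat p m)))) = 1 ∧
      ∀ a ∈ H₁, ∀ b ∈ H₂, ∀ g ∈ H₃, a * b * g ≠ 1 →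
        (∑ M, c M * ZMod.stdAddChar (Matrix.trace (M * ((a * b * g : GLm p m) : Mat p m)))) = 0)
    (hg1 : g ∈ H₁) (hg : (g : Mat p m) = 1 + vecMulVec u φ) (hu : u ≠ 0) (hφ : φ ≠ 0) :
    (Nat.card H₃ + (Nat.card H₂ - 1)) * Nat.card H₁ ≤
      p ^ (m - 1) * (p - 1) * Nat.card (ℙ (ZMod p) (Fin m → ZMod p)) := by
  obtain ⟨σ, hσ⟩ := exists_char_zpowers hg hu hφ
  have h := crux_law_left' htpp hdes ((Subgroup.zpowers_le (G := GLm p m)).2 hg1) hσ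
  rw [← mul_assoc] at h
  exact h.trans (Nat.mul_le_mul_right _ (card_mul_card_admOrb_zpowers_le hg hu hφ hσ))

/-- **RANK-ONE LAW, middle member**: `x · y ≤ p^{m-1} (p − 1) · b` and `z · y ≤ p^{m-1} (p − 1) · b`. -/
theorem crux_middle (htpp : SubgroupTPP H₁ H₂ H₃)
    (hdes : ∃ c : Mat p m → ℂ, (∀ M, 1 < M.rank → c M = 0) ∧
      (∑ M, c M * ZMod.stdAddChar (Matrix.trace (M * ((1 : GLm p m) : Mat p m)))) = 1 ∧
      ∀ a ∈ H₁, ∀ b ∈ H₂, ∀ g ∈ H₃, a * b * g ≠ 1 →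
        (∑ M, c M * ZMod.stdAddChar (Matrix.trace (M * ((a * b * g : GLm p m) : Mat p m)))) = 0)
    (hg2 : g ∈ H₂) (hg : (g : Mat p m) = 1 + vecMulVec u φ) (hu : u ≠ 0) (hφ : φ ≠ 0) :
    Nat.card H₁ * Nat.card H₂ ≤ p ^ (m - 1) * (p - 1) * Nat.card (ℙ (ZMod p) (Fin m → ZMod p)) ∧
      Nat.card H₃ * Nat.card H₂ ≤
        p ^ (m - 1) * (p - 1) * Nat.card (ℙ (ZMod p) (Fin m → ZMod p)) := by
  obtain ⟨σ, hσ⟩ := exists_char_zpowers hg hu hφ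
  obtain ⟨h, h'⟩ := crux_law_middle' htpp hdes ((Subgroup.zpowers_le (G := GLm p m)).2 hg2) hσ
  rw [← mul_assoc] at h h'
  have hc := card_mul_card_admOrb_zpowers_le hg hu hφ hσ
  exact ⟨h.trans (Nat.mul_le_mul_right _ hc), h'.trans (Nat.mul_le_mul_right _ hc)⟩

/-- Numeric form at `m = 1 + l`: `p^{m-1} (p − 1) b = p^l (p^{1+l} − 1)`. -/
theorem rhs_formula (l : ℕ) :
    p ^ (1 + l - 1) * (p - 1) * Nat.card (ℙ (ZMod p) (Fin (1 + l) → ZMod p)) =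
      p ^ l * (p ^ (1 + l) - 1) := by
  rw [CharacterLaw.card_proj_eq l, Nat.add_sub_cancel_left, mul_assoc,
    Nat.mul_div_cancel' ?_]
  simpa using Nat.sub_dvd_pow_sub_pow p 1 (1 + l)

/-- **RANK-ONE LAW at `m = 1 + l`, third member, closed form**: `(x + y − 1) z ≤ p^l (p^{1+l} − 1)`. -/
theorem crux_right_formula {l : ℕ} {H₁ H₂ H₃ : Subgroup (GLm p (1 + l))} {g : GLm p (1 + l)}
    {u φ : Fin (1 + l) → ZMod p} (htpp : SubgroupTPP H₁ H₂ H₃)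
    (hdes : ∃ c : Mat p (1 + l) → ℂ, (∀ M, 1 < M.rank → c M = 0) ∧
      (∑ M, c M * ZMod.stdAddChar (Matrix.trace (M * ((1 : GLm p (1 + l)) : Mat p (1 + l))))) = 1 ∧
      ∀ a ∈ H₁, ∀ b ∈ H₂, ∀ g ∈ H₃, a * b * g ≠ 1 →
        (∑ M, c M * ZMod.stdAddChar
          (Matrix.trace (M * ((a * b * g : GLm p (1 + l)) : Mat p (1 + l))))) = 0)
    (hg3 : g ∈ H₃) (hg : (g : Mat p (1 + l)) = 1 + vecMulVec u φ) (hu : u ≠ 0) (hφ : φ ≠ 0) :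
    (Nat.card H₁ + (Nat.card H₂ - 1)) * Nat.card H₃ ≤ p ^ l * (p ^ (1 + l) - 1) := by
  rw [← rhs_formula l]
  exact crux_right htpp hdes hg3 hg hu hφ

end Law

end RankOneLaw
end Summit.MatrixMultiplication.MatrixMultiplication.Theorems.SubgroupIdentityDesigns.Negative
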